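import Literature.Probability.Percolation.QuadCrossingRotationInvarianceProofs
import Literature.Probability.Percolation.QuadCrossingMeasurability
import HarnessLib

/-!
# DKKMO Cor. 1.3 (`q = 1`) from a coupling of crossing indicators (proved reduction)

Topic `Probability/Percolation`; third sibling proofs file of
`QuadCrossingRotationInvariance.lean`, whose named fact `dkkmo_crossing_rotation_invariance`
vendors Duminil-Copin–Kozlowski–Krachun–Manolescu–Oulamara, arXiv:2012.11672v1, Corollary 1.3
at `q = 1` (per quad `Q` and `ε > 0`: for `α ∈ (ε, π - ε)` and `δ < δ₀(Q, ε)`,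
`|P_{1/2}[𝒞_δ(e^{iα}Q)] - P_{1/2}[𝒞_δ(Q)]| ≤ ε`).

The printed proof (§7.1, p. 43) is one sentence: "the result follows directly from Theorem 1.2
and the measurability of `𝒞(Q)` in the Schramm–Smirnov topology". Theorem 1.2 (v1, p. 5)
provides, for `α ∈ (ε, π - ε)` and `δ ≤ δ₀`, a coupling `ℙ` of `ω_δ ∼ φ_{Ω_δ}` and
`ω'_δ ∼ φ_{(e^{-iα}Ω)_δ}` with `ℙ[d_SS(ω_δ, e^{iα}ω'_δ) > ε] < ε`; reading the crossing event of
the fixed quad `Q` on both sides (`Q` is crossed by `e^{iα}ω'` iff `e^{-iα}Q` is crossed by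
`ω'`), one gets a coupling of two critical percolations under which the indicators of
`𝒞_δ(Q)` (first coordinate) and of `𝒞_δ(e^{-iα}Q)` (second coordinate) disagree with small
probability. This file proves that this **crossing-coupling statement implies the fact**
(`dkkmo_crossing_rotation_invariance_of_coupling`): the measure-theoretic step (a coupling
bounds the difference of the marginal probabilities by the probability of disagreement,
`abs_measureReal_sub_le_of_coupling`, using the measurability of the crossing event,
`measurableSet_quadCrossing`) and the angle bookkeeping `e^{-i(π-α)}Q ↦ e^{iα}Q`
(`α ↦ π - α` preserves `(ε, π - ε)`, and `P[𝒞_δ(e^{-iπ}e^{iα}Q)] = P[𝒞_δ(e^{iα}Q)]` by the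
lattice symmetry `quadCrossingProb_rotateQuad_add_int_mul_pi_div_two`).

What is NOT here: the crossing-coupling statement itself — it is the `d_SS` half of DKKMO's
Theorem 1.2 read on one quad together with the a.s. continuity of `𝒞(Q)` (Schramm–Smirnov 2011
§5), and rests on the undischarged named facts `dkkmo_theorem_1_2` / `dkkmo_theorem_1_7` of
`LoopRepresentation.lean`. It enters below only as the explicit hypothesis of the reduction (no
named fact is introduced).

## References

* [DKKMO2020Rotational] H. Duminil-Copin, K. K. Kozlowski, D. Krachun, I. Manolescu,
  M. Oulamara, arXiv:2012.11672v1 (2020), Thm. 1.2 and Cor. 1.3 p. 5, §7.1 p. 43.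
-/

noncomputable section

open MeasureTheory Set
open scoped symmDiff
open Literature.Probability.LatticeModels Literature.Probability.RandomPlanarGeometry

namespace Literature.Probability.Percolation

/-! ### The coupling inequality -/

/-- **Coupling inequality.** If `P` couples `μ` and `ν` (a finite measure on `X × X` with
marginals `μ`, `ν`), then for measurable `A`, `B` the difference `|μ(A) - ν(B)|` is at most the
`P`-probability that the indicator of `A` on the first coordinate and the indicator of `B` on the
second disagree, i.e. `P((A × X) ∆ (X × B))`. [folklore] -/
theorem abs_measureReal_sub_le_of_coupling {X : Type*} [MeasurableSpace X] {μ ν : Measure X}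
    (P : Measure (X × X)) [IsFiniteMeasure P] (h₁ : P.map Prod.fst = μ)
    (h₂ : P.map Prod.snd = ν) {A B : Set X} (hA : MeasurableSet A) (hB : MeasurableSet B) :
    |μ.real A - ν.real B| ≤ P.real ((Prod.fst ⁻¹' A) ∆ (Prod.snd ⁻¹' B)) := by
  rw [← h₁, ← h₂, map_measureReal_apply measurable_fst hA,
    map_measureReal_apply measurable_snd hB]
  set S : Set (X × X) := Prod.fst ⁻¹' A
  set T : Set (X × X) := Prod.snd ⁻¹' B
  have hST : S ⊆ T ∪ S ∆ T := fun x hx => by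
    by_cases hT : x ∈ T
    · exact Or.inl hT
    · exact Or.inr (mem_symmDiff.2 (Or.inl ⟨hx, hT⟩))
  have hTS : T ⊆ S ∪ S ∆ T := fun x hx => by
    by_cases hS : x ∈ S
    · exact Or.inl hS
    · exact Or.inr (mem_symmDiff.2 (Or.inr ⟨hx, hS⟩))
  have h1 : P.real S ≤ P.real T + P.real (S ∆ T) :=
    (measureReal_mono hST).trans (measureReal_union_le T (S ∆ T))
  have h2 : P.real T ≤ P.real S + P.real (S ∆ T) :=
    (measureReal_mono hTS).trans (measureReal_union_le S (S ∆ T))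
  rw [abs_sub_le_iff]
  constructor <;> linarith

/-- A measure on a product whose first marginal is a probability measure is a probability
measure. [folklore] -/
theorem isProbabilityMeasure_of_map_fst {X Y : Type*} [MeasurableSpace X] [MeasurableSpace Y]
    {P : Measure (X × Y)} {μ : Measure X} [IsProbabilityMeasure μ] (h : P.map Prod.fst = μ) :
    IsProbabilityMeasure P := by
  refine ⟨?_⟩
  have hu : P.map Prod.fst univ = 1 := by rw [h, measure_univ]
  rwa [Measure.map_apply measurable_fst MeasurableSet.univ, preimage_univ] at hu

/-! ### The reduction -/

/-- **DKKMO Cor. 1.3 at `q = 1` from the crossing-coupling form of Theorem 1.2.** Suppose that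
for every quad `Q` and `ε > 0` there is `δ₀ > 0` such that for every `α ∈ (ε, π - ε)` and
`δ ∈ (0, δ₀)` the two critical bond percolations can be coupled so that the events "`Q` is
crossed at mesh `δ`" for the first configuration and "`e^{-iα}Q` is crossed at mesh `δ`" for the
second disagree with probability at most `ε` (this is what Theorem 1.2 of DKKMO — a coupling
with `ℙ[d_SS(ω_δ, e^{iα}ω'_δ) > ε] < ε` — yields on the fixed quad `Q` by the a.s. continuity of
`𝒞(Q)`, since `e^{iα}ω'` crosses `Q` iff `ω'` crosses `e^{-iα}Q`; §7.1, p. 43). Then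
`dkkmo_crossing_rotation_invariance` holds: the coupling inequality gives
`|P[𝒞_δ(Q)] - P[𝒞_δ(e^{-iβ}Q)]| ≤ ε` for `β ∈ (ε, π - ε)`, and with `β = π - α` the quad
`e^{-iβ}Q = e^{-iπ}(e^{iα}Q)` has the same crossing probability as `e^{iα}Q` by the symmetry
of `ℤ²` under the half-turn. [cite: DKKMO2020Rotational, Cor. 1.3 (q = 1), proof §7.1 p. 43] -/
theorem dkkmo_crossing_rotation_invariance_of_coupling
    (H : ∀ (R : ConformalRectangle) (ε : ℝ), 0 < ε → ∃ δ₀ : ℝ, 0 < δ₀ ∧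
      ∀ α ∈ Set.Ioo ε (Real.pi - ε), ∀ δ ∈ Set.Ioo (0 : ℝ) δ₀,
        ∃ P : Measure (BondConfig (Site 2) × BondConfig (Site 2)),
          P.map Prod.fst = bondPercolation (zdGraph 2) half ∧
          P.map Prod.snd = bondPercolation (zdGraph 2) half ∧
          P.real ((Prod.fst ⁻¹' quadCrossing R δ) ∆
            (Prod.snd ⁻¹' quadCrossing (rotateQuad (-α) R) δ)) ≤ ε) :
    dkkmo_crossing_rotation_invariance := by
  intro R ε hε
  obtain ⟨δ₀, hδ₀, h⟩ := H R ε hε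
  refine ⟨δ₀, hδ₀, fun α hα δ hδ => ?_⟩
  have hβ : Real.pi - α ∈ Set.Ioo ε (Real.pi - ε) := ⟨by linarith [hα.2], by linarith [hα.1]⟩
  obtain ⟨P, h1, h2, hP⟩ := h (Real.pi - α) hβ δ hδ
  haveI : IsProbabilityMeasure P := isProbabilityMeasure_of_map_fst h1
  have key : |quadCrossingProb δ R - quadCrossingProb δ (rotateQuad (-(Real.pi - α)) R)| ≤ ε :=
    (abs_measureReal_sub_le_of_coupling P h1 h2 (measurableSet_quadCrossing R hδ.1)
      (measurableSet_quadCrossing _ hδ.1)).trans hP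
  have hang : quadCrossingProb δ (rotateQuad (-(Real.pi - α)) R) =
      quadCrossingProb δ (rotateQuad α R) := by
    have e : -(Real.pi - α) = α + ((-2 : ℤ) : ℝ) * (Real.pi / 2) := by push_cast; ring
    rw [e, quadCrossingProb_rotateQuad_add_int_mul_pi_div_two]
  rw [hang, abs_sub_comm] at key
  exact key

end Literature.Probability.Percolation
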